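import Mathlib
import HarnessLib
import Summits.AtomisticToContinuum.FouriersLaw.Theses.JunctionLocality
import Summits.AtomisticToContinuum.FouriersLaw.Theorems.JunctionLocalitySuperadditiveResistanceStubKappaFrame

/-!
# Bypass-bound helpers VI: the GRAM FORM of the resolvent Kubo diagonal and the free gradient budget
(helpers `--supports` stmt-AtomisticToContinuum-11748 for stub `stub_bypassBound` (S2') of line
`floating-probe-bypass-laplacian`, skeleton v7, crux `JunctionLocality.SuperadditiveResistance`)

Notation as in parts IV–V (`…StubBypassBoundAux4/5`): `g` a family of `κ`-resolvent fields of the four terminals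
(sites `s = (0, N−1, N, N+M−1)`) of the `(N, M)`-device, `K` its resolvent Kubo matrix, `x = −K₀₃`, `a = K₀₀`,
`b = K₃₃`, `L = N + M`. Part IV bounds the bypass by the far-gradient NORM, `x ≤ γ² T^{-1/2}‖∂_{p_{L−1}} g_0‖_{L²(μ_T)}`.
This file records what the resolvent Kubo structure gives about that norm FOR FREE, `N`-uniformly:

* `kuboDiag_eq_gram` — the **Gram (sum-of-squares) form** of a diagonal entry (fixed `N`, exact, any `κ`):
  `K_aa = (γ²/T²)·(κ‖g_a‖² + γT·Σ_c ‖∂_{p_{s_c}} g_a − δ_{ca} p_{s_c}/γ‖²)` in `L²(μ_T)` — fluctuation–dissipation with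
  the mass term (`resolvent_fd`), Gaussian integration by parts at the own site (`gauss_ibp`) and completion of the
  square (the `θ = e_a` case of the landed `resolvent_comb_kinetic_le`, keeping the identity);
* `gradient_sq_le_kuboDiag`, **`helper_bypassGradientBudget`** (registered: `farGradient_sq_le_kuboDiag` ∧
  `nearGradient_sq_le_kuboDiag`) — hence for `κ ≥ 0` every FOREIGN bath gradient is paid for by the self-coefficient:
  `(γ³/T)‖∂_{p_{L−1}} g_0‖² ≤ a` and `(γ³/T)‖∂_{p_0} g_3‖² ≤ b`;
* `kuboMatrix_zero_three_eq_gram` — the bypass entry is the Gram PAIRING of the same vectors: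
  `K₀₃ = (γ²/T²)(κ⟨g_0,g_3⟩ + γTΣ_c⟨∂_{p_{s_c}}g_0, ∂_{p_{s_c}}g_3⟩ − T(⟨p_0, ∂_{p_0}g_3⟩ + ⟨∂_{p_{L−1}}g_0, p_{L−1}⟩))`
  (polarised fluctuation–dissipation `polar` with mass terms + Onsager symmetry + Gaussian IBP at both ends), i.e.
  `K = (γ²/T²)·Gram(√κ g_a, √(γT) v^a)` with `v_c^a = ∂_{p_{s_c}} g_a − δ_{ca} p_{s_c}/γ`: S2' (`−K₀₃ ≤ C₃ K₀₀ K₃₃`) says the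
  two END vectors become orthogonal at the rate `√(K₀₀K₃₃)`, one order beyond Cauchy–Schwarz (= the PSD bound).

Consequence for S2' (`x ≤ C₃ab`, `N`-uniform): the norm route of part IV yields only `x ≤ √(γa)` (and `√(γb)`), weaker
than the PSD bound `x² ≤ ab`; the missing factor `√a·b` must come from the PAIRING `⟨∂_{p_{L−1}} g_0, p_{L−1}⟩` being
much smaller than the norm allows — the "double escape" content isolated in part V as `FarTransmissionRemainderBoundκ`.
Standard axioms only; nothing taken as a named fact.
-/

noncomputable section

open MeasureTheory Filter Topology
open scoped ContDiff
open Literature.MathematicalPhysics.KineticTheory.HeatConduction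
open Summit.AtomisticToContinuum.FouriersLaw.Theorems.SuperadditiveResistance.DeviceLiouville
  (kin deviceGenerator deviceWeight deviceGenerator_eq kin_eq_sq liouvilleOp bathOp)
open Summit.AtomisticToContinuum.FouriersLaw.Theorems.SuperadditiveResistance.Kubo
  (termWeight termWeight_nonneg termWeight_pos sum_termWeight_mul resolvent_fd gauss_ibp polar resolvent_kuboPair_symm
    integral_sub_sq_mul_gibbsDensity integral_sq_mul_gibbsDensity_eq memLp_partialP memLp_kinetic
    integrable_mul_mul_gibbsDensity partition_pos)

namespace Summit.AtomisticToContinuum.FouriersLaw.Cruxes.SuperadditiveResistance.FloatingProbeBypassLaplacian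

section Gram

variable {ω₂ lam β γ T : ℝ} {N M : ℕ}

/-- Terminal `3` is the far bath on site `N+M−1`. -/
theorem termFin_three {N M : ℕ} (hN : 1 ≤ N) (hM : 1 ≤ M) :
    termFin N M hN hM 3 = ⟨N + M - 1, by omega⟩ := Fin.ext (termSite_three N M)

/-- Terminal `0` is the near bath on site `0` (`N, M ≥ 1` form of `termFin_zero`). -/
theorem termFin_zero' {N M : ℕ} (hN : 1 ≤ N) (hM : 1 ≤ M) :
    termFin N M hN hM 0 = ⟨0, by omega⟩ := Fin.ext (termSite_zero N M)

/-- **GRAM (SUM-OF-SQUARES) FORM OF A DIAGONAL ENTRY OF THE RESOLVENT KUBO MATRIX (fixed `N`; exact).** For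
`N, M ≥ 2`, any `κ` and a `κ`-resolvent field `g_a` of terminal `a` (sites `s = (0, N−1, N, N+M−1)`):

  `K_aa = (γ²/T²)·(κ‖g_a‖²_{L²(μ_T)} + γT·Σ_c ‖∂_{p_{s_c}} g_a − δ_{ca} p_{s_c}/γ‖²_{L²(μ_T)})`

— fluctuation–dissipation with the mass term (`resolvent_fd`), Gaussian integration by parts at the own site
(`gauss_ibp`) and completion of the square (the `θ = e_a` case of the landed `resolvent_comb_kinetic_le`, with the
identity kept). Every summand is non-negative: the self-coefficient `a = K₀₀` (resp. `b = K₃₃`) is a BUDGET for the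
bath gradients of `g_0` (resp. `g_3`), `N`-uniformly. -/
theorem kuboDiag_eq_gram (hω : 0 < ω₂) (hl : 0 ≤ lam) (hβ : 0 ≤ β) (hγ : 0 < γ) (hT : 0 < T)
    (hN : 2 ≤ N) (hM : 2 ≤ M) (κ : ℝ) (g : Fin 4 → PhaseSpace (N + M) → ℝ) (a : Fin 4)
    (hga : g a ∈ deviceResolventFields ω₂ lam β γ T N M (termSite N M a) κ) :
    kuboMatrix ω₂ lam β γ T N M g a a = γ ^ 2 / T ^ 2 *
      (κ * ∫ x, g a x ^ 2 ∂((pinnedChain ω₂ lam β γ).gibbsMeasure (N + M) T) +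
        γ * T * ∑ c : Fin 4, ∫ x, (partialP (termFin N M (by omega) (by omega) c) (g a) x -
            (if c = a then 1 / γ else 0) * x.2 (termFin N M (by omega) (by omega) c)) ^ 2
          ∂((pinnedChain ω₂ lam β γ).gibbsMeasure (N + M) T)) := by
  have hN1 : 1 ≤ N := by omega
  have hM1 : 1 ≤ M := by omega
  set s := termFin N M hN1 hM1 with hs_def
  have hs : Function.Injective s := termFin_injective hN hM
  have hBw : deviceWeight N M = termWeight s := deviceWeight_eq_termWeight hN hM
  obtain ⟨hgC, hgL, hpde⟩ := hga
  set P := pinnedChain ω₂ lam β γ with hP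
  set ρ := P.gibbsDensity (N + M) T with hρ
  set Z : ℝ := ∫ x, ρ x with hZ
  have hZpos : 0 < Z := partition_pos hω hl hβ (N + M) hT
  have hkin : ∀ x : PhaseSpace (N + M), kin (N + M) (termSite N M a) x = x.2 (s a) ^ 2 := fun x =>
    kin_eq_sq (termSite_lt hN1 hM1 a) x
  -- the resolvent pair with `B = termWeight s`
  have hpair : ∀ x, 1 * liouvilleOp P (N + M) (g a) x + γ * bathOp (N + M) (termWeight s) T (g a) x =
      -((x.2 (s a) ^ 2 - T) - κ * g a x) := by
    intro x
    have e := hpde x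
    have hγP : P.γ = γ := rfl
    rw [hkin x, deviceGenerator_eq, hBw, hγP] at e
    linarith
  have hk : MemLp (fun x : PhaseSpace (N + M) => x.2 (s a) ^ 2 - T) 2 (P.gibbsMeasure (N + M) T) :=
    memLp_kinetic hω hl hβ (N + M) hT (s a)
  have hk' : MemLp (fun x : PhaseSpace (N + M) => (x.2 (s a) ^ 2 - T) - κ * g a x) 2 (P.gibbsMeasure (N + M) T) :=
    hk.sub (hgL.const_mul κ)
  have hd : ∀ c, MemLp (partialP (s c) (g a)) 2 (P.gibbsMeasure (N + M) T) := fun c =>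
    memLp_partialP hω hl hβ γ (N + M) hT (termWeight s) (termWeight_nonneg s) 1 hγ hgC hgL hk' hpair
      (termWeight_pos s hs c)
  -- named quantities (density form)
  set I : ℝ := ∫ x, g a x * (x.2 (s a) ^ 2 - T) * ρ x with hI
  set G2 : ℝ := ∫ x, g a x ^ 2 * ρ x with hG2
  set D : Fin 4 → ℝ := fun c => ∫ x, partialP (s c) (g a) x ^ 2 * ρ x with hD
  set Pc : Fin 4 → ℝ := fun c => ∫ x, x.2 (s c) * partialP (s c) (g a) x * ρ x with hPc
  set Q : Fin 4 → ℝ := fun c =>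
    ∫ x, (partialP (s c) (g a) x - (if c = a then 1 / γ else 0) * x.2 (s c)) ^ 2 * ρ x with hQ
  -- (FD with mass) I = κ G2 + γ T Σ_c D_c
  have hFD : I = κ * G2 + γ * T * ∑ c, D c := by
    have h := resolvent_fd hω hl hβ (N + M) hT (termWeight s) (termWeight_nonneg s) 1 hγ κ hgC hgL hk hpair
    rw [sum_termWeight_mul s fun i => ∫ x, partialP i (g a) x ^ 2 * ρ x] at h
    simpa only [hI, hG2, hD] using h
  -- (Gauss) I = T P_a
  have hG : I = T * Pc a := by
    have h := gauss_ibp hω hl hβ (N + M) hT (s a) (hgC.of_le (by norm_cast) : ContDiff ℝ 1 (g a)) hgL (hd a)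
    have e : ∫ x, (x.2 (s a) ^ 2 - T) * g a x * ρ x = I :=
      integral_congr_ae (ae_of_all _ fun x => by ring)
    rw [e] at h
    simpa only [hPc] using h
  -- equipartition
  have hM2 : ∀ c, ∫ x, x.2 (s c) ^ 2 * ρ x = T * Z := fun c => integral_sq_mul_gibbsDensity_eq hω hl hβ (N + M) hT (s c)
  -- completion of the square, term by term
  have hQexp : ∀ c, Q c = D c - 2 * (if c = a then 1 / γ else 0) * Pc c + (if c = a then 1 / γ else 0) ^ 2 * (T * Z) := by
    intro c
    simp only [hQ, hD, hPc]
    rw [integral_sub_sq_mul_gibbsDensity hω hl hβ (N + M) hT (hd c) _ (s c), hM2 c]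
  have hsumQ : ∑ c, Q c = (∑ c, D c) - 2 / γ * Pc a + T * Z / γ ^ 2 := by
    simp only [hQexp, Finset.sum_add_distrib, Finset.sum_sub_distrib]
    have e1 : ∑ c : Fin 4, 2 * (if c = a then 1 / γ else 0) * Pc c = 2 / γ * Pc a := by
      simp only [mul_ite, ite_mul, mul_zero, zero_mul, Finset.sum_ite_eq', Finset.mem_univ, if_true]
      ring
    have e2 : ∑ c : Fin 4, (if c = a then 1 / γ else 0) ^ 2 * (T * Z) = T * Z / γ ^ 2 := by
      simp only [ite_pow, ite_mul, zero_pow two_ne_zero, zero_mul, Finset.sum_ite_eq', Finset.mem_univ, if_true]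
      field_simp
    rw [e1, e2]
  -- the diagonal entry in density form
  have hK : kuboMatrix ω₂ lam β γ T N M g a a = γ - γ ^ 2 / T ^ 2 * (Z⁻¹ * I) := by
    simp only [kuboMatrix, if_true, hkin]
    rw [P.integral_gibbsMeasure]
  -- the right-hand side in density form
  have hR1 : ∫ x, g a x ^ 2 ∂(P.gibbsMeasure (N + M) T) = Z⁻¹ * G2 := by rw [P.integral_gibbsMeasure]
  have hR2 : ∀ c, ∫ x, (partialP (s c) (g a) x - (if c = a then 1 / γ else 0) * x.2 (s c)) ^ 2
      ∂(P.gibbsMeasure (N + M) T) = Z⁻¹ * Q c := fun c => by rw [P.integral_gibbsMeasure]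
  rw [hK, hR1]
  simp_rw [hR2]
  rw [← Finset.mul_sum, hsumQ]
  have hZ0 : Z ≠ 0 := hZpos.ne'
  have hγ0 : γ ≠ 0 := hγ.ne'
  have hT0 : T ≠ 0 := hT.ne'
  have key : I = κ * G2 + γ * T * ∑ c, D c := hFD
  have key2 : T * Pc a = I := hG.symm
  field_simp
  linear_combination (2 * γ) * key2 + γ * key

/-- **A foreign bath gradient is paid for by the self-coefficient** (`N`-uniform): for `κ ≥ 0`, a `κ`-resolvent field
`g_a` of terminal `a` and every OTHER terminal `b ≠ a`, `(γ³/T)·‖∂_{p_{s_b}} g_a‖²_{L²(μ_T)} ≤ K_aa` (one summand of the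
Gram form `kuboDiag_eq_gram`). -/
theorem gradient_sq_le_kuboDiag (hω : 0 < ω₂) (hl : 0 ≤ lam) (hβ : 0 ≤ β) (hγ : 0 < γ) (hT : 0 < T)
    (hN : 2 ≤ N) (hM : 2 ≤ M) {κ : ℝ} (hκ : 0 ≤ κ) (g : Fin 4 → PhaseSpace (N + M) → ℝ) (a : Fin 4)
    (hga : g a ∈ deviceResolventFields ω₂ lam β γ T N M (termSite N M a) κ) {b : Fin 4} (hb : b ≠ a) :
    γ ^ 3 / T * ∫ x, partialP (termFin N M (by omega) (by omega) b) (g a) x ^ 2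
        ∂((pinnedChain ω₂ lam β γ).gibbsMeasure (N + M) T) ≤ kuboMatrix ω₂ lam β γ T N M g a a := by
  rw [kuboDiag_eq_gram hω hl hβ hγ hT hN hM κ g a hga]
  set Q : Fin 4 → ℝ := fun c => ∫ x, (partialP (termFin N M (by omega) (by omega) c) (g a) x -
      (if c = a then 1 / γ else 0) * x.2 (termFin N M (by omega) (by omega) c)) ^ 2
    ∂((pinnedChain ω₂ lam β γ).gibbsMeasure (N + M) T) with hQ
  have hQnn : ∀ c, 0 ≤ Q c := fun c => integral_nonneg fun x => sq_nonneg _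
  have hQb : Q b = ∫ x, partialP (termFin N M (by omega) (by omega) b) (g a) x ^ 2
      ∂((pinnedChain ω₂ lam β γ).gibbsMeasure (N + M) T) := by
    simp only [hQ, if_neg hb, zero_mul, sub_zero]
  have hsingle : Q b ≤ ∑ c, Q c := Finset.single_le_sum (fun c _ => hQnn c) (Finset.mem_univ b)
  have hG2 : 0 ≤ κ * ∫ x, g a x ^ 2 ∂((pinnedChain ω₂ lam β γ).gibbsMeasure (N + M) T) :=
    mul_nonneg hκ (integral_nonneg fun x => sq_nonneg _)
  rw [← hQb]
  have hc : 0 ≤ γ ^ 2 / T ^ 2 := by positivity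
  have hγT : 0 ≤ γ * T := by positivity
  have e : γ ^ 3 / T * Q b = γ ^ 2 / T ^ 2 * (γ * T * Q b) := by
    have hT0 : T ≠ 0 := hT.ne'
    field_simp
  rw [e]
  exact mul_le_mul_of_nonneg_left (by nlinarith [mul_le_mul_of_nonneg_left hsingle hγT]) hc

/-- **The far-gradient budget of the near field**: `(γ³/T)·‖∂_{p_{L−1}} g_0‖²_{L²(μ_T)} ≤ K₀₀ = a` (`N, M ≥ 2`,
`κ ≥ 0`; terminal `b = 3` of `gradient_sq_le_kuboDiag` at `a = 0`). With `bypass_le_farGradientNorm` this gives only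
`x ≤ √(γ a)`: S2' (`x ≤ C₃ a b`) needs the far gradient's PAIRING with `p_{L−1}` to be smaller than its norm allows by
a factor `√a · b` — the genuinely `N`-uniform content ("double escape"). -/
theorem farGradient_sq_le_kuboDiag (hω : 0 < ω₂) (hl : 0 ≤ lam) (hβ : 0 ≤ β) (hγ : 0 < γ) (hT : 0 < T)
    (hN : 2 ≤ N) (hM : 2 ≤ M) {κ : ℝ} (hκ : 0 ≤ κ) (g : Fin 4 → PhaseSpace (N + M) → ℝ)
    (hg₀ : g 0 ∈ deviceResolventFields ω₂ lam β γ T N M 0 κ) :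
    γ ^ 3 / T * ∫ x, partialP ⟨N + M - 1, by omega⟩ (g 0) x ^ 2 ∂((pinnedChain ω₂ lam β γ).gibbsMeasure (N + M) T) ≤
      kuboMatrix ω₂ lam β γ T N M g 0 0 := by
  have h := gradient_sq_le_kuboDiag hω hl hβ hγ hT hN hM hκ g 0 hg₀ (b := 3) (by decide)
  rwa [termFin_three] at h

/-- **The near-gradient budget of the far field**: `(γ³/T)·‖∂_{p_0} g_3‖²_{L²(μ_T)} ≤ K₃₃ = b` (mirror of
`farGradient_sq_le_kuboDiag`). -/
theorem nearGradient_sq_le_kuboDiag (hω : 0 < ω₂) (hl : 0 ≤ lam) (hβ : 0 ≤ β) (hγ : 0 < γ) (hT : 0 < T)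
    (hN : 2 ≤ N) (hM : 2 ≤ M) {κ : ℝ} (hκ : 0 ≤ κ) (g : Fin 4 → PhaseSpace (N + M) → ℝ)
    (hg₃ : g 3 ∈ deviceResolventFields ω₂ lam β γ T N M (N + M - 1) κ) :
    γ ^ 3 / T * ∫ x, partialP ⟨0, by omega⟩ (g 3) x ^ 2 ∂((pinnedChain ω₂ lam β γ).gibbsMeasure (N + M) T) ≤
      kuboMatrix ω₂ lam β γ T N M g 3 3 := by
  have h := gradient_sq_le_kuboDiag hω hl hβ hγ hT hN hM hκ g 3 hg₃ (b := 0) (by decide)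
  rwa [termFin_zero'] at h

/-- **GRAM FORM OF THE BYPASS ENTRY (fixed `N`; exact).** For `N, M ≥ 2`, any `κ` and a family of `κ`-resolvent fields
of the four terminals, the end-to-end entry of the resolvent Kubo matrix is the Gram pairing of the SAME vectors
whose squared norms give the diagonal (`kuboDiag_eq_gram`):

  `K₀₃ = (γ²/T²)·(κ⟨g_0, g_3⟩ + γT·Σ_c ⟨∂_{p_{s_c}} g_0, ∂_{p_{s_c}} g_3⟩ − T·(⟨p_0, ∂_{p_0} g_3⟩ + ⟨∂_{p_{L−1}} g_0, p_{L−1}⟩))`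

in `L²(μ_T)` (`= (γ²/T²)(κ⟨g_0,g_3⟩ + γTΣ_c⟨v_c⁰, v_c³⟩)`, `v_c^a = ∂_{p_{s_c}} g_a − δ_{ca} p_{s_c}/γ`) — the polarised
fluctuation–dissipation identity (`polar`) with the mass terms, Onsager symmetry (`resolvent_kuboPair_symm`) and
Gaussian integration by parts at both ends. With `kuboDiag_eq_gram`: `K = (γ²/T²)·Gram` of the vectors
`(√κ g_a, √(γT) v_0^a, …, √(γT) v_3^a)`, so S2' (`−K₀₃ ≤ C₃ K₀₀ K₃₃`) says that the END vectors become orthogonal at the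
rate `√(K₀₀ K₃₃)` — beyond Cauchy–Schwarz, which is the PSD bound `K₀₃² ≤ K₀₀ K₃₃`. -/
theorem kuboMatrix_zero_three_eq_gram (hω : 0 < ω₂) (hl : 0 ≤ lam) (hβ : 0 ≤ β) (hγ : 0 < γ) (hT : 0 < T)
    (hN : 2 ≤ N) (hM : 2 ≤ M) (κ : ℝ) (g : Fin 4 → PhaseSpace (N + M) → ℝ)
    (hg : ∀ a : Fin 4, g a ∈ deviceResolventFields ω₂ lam β γ T N M (termSite N M a) κ) :
    kuboMatrix ω₂ lam β γ T N M g 0 3 = γ ^ 2 / T ^ 2 *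
      (κ * ∫ x, g 0 x * g 3 x ∂((pinnedChain ω₂ lam β γ).gibbsMeasure (N + M) T) +
        γ * T * ∑ c : Fin 4, ∫ x, partialP (termFin N M (by omega) (by omega) c) (g 0) x *
            partialP (termFin N M (by omega) (by omega) c) (g 3) x ∂((pinnedChain ω₂ lam β γ).gibbsMeasure (N + M) T) -
          T * ((∫ x, x.2 ⟨0, by omega⟩ * partialP ⟨0, by omega⟩ (g 3) x
              ∂((pinnedChain ω₂ lam β γ).gibbsMeasure (N + M) T)) +
            ∫ x, x.2 ⟨N + M - 1, by omega⟩ * partialP ⟨N + M - 1, by omega⟩ (g 0) x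
              ∂((pinnedChain ω₂ lam β γ).gibbsMeasure (N + M) T))) := by
  have hN1 : 1 ≤ N := by omega
  have hM1 : 1 ≤ M := by omega
  set s := termFin N M hN1 hM1 with hs_def
  have hs : Function.Injective s := termFin_injective hN hM
  have hBw : deviceWeight N M = termWeight s := deviceWeight_eq_termWeight hN hM
  have hs0 : s 0 = ⟨0, by omega⟩ := termFin_zero' hN1 hM1
  have hs3 : s 3 = ⟨N + M - 1, by omega⟩ := termFin_three hN1 hM1
  set P := pinnedChain ω₂ lam β γ with hP
  set ρ := P.gibbsDensity (N + M) T with hρ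
  set Z : ℝ := ∫ x, ρ x with hZ
  have hZpos : 0 < Z := partition_pos hω hl hβ (N + M) hT
  have hgC : ∀ a, ContDiff ℝ 2 (g a) := fun a => (hg a).1
  have hgL : ∀ a, MemLp (g a) 2 (P.gibbsMeasure (N + M) T) := fun a => (hg a).2.1
  have hkin : ∀ (a : Fin 4) (x : PhaseSpace (N + M)), kin (N + M) (termSite N M a) x = x.2 (s a) ^ 2 :=
    fun a x => kin_eq_sq (termSite_lt hN1 hM1 a) x
  have hpair : ∀ a x, 1 * liouvilleOp P (N + M) (g a) x + γ * bathOp (N + M) (termWeight s) T (g a) x =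
      -((x.2 (s a) ^ 2 - T) - κ * g a x) := by
    intro a x
    have e := (hg a).2.2 x
    have hγP : P.γ = γ := rfl
    rw [hkin a x, deviceGenerator_eq, hBw, hγP] at e
    linarith
  have hk : ∀ a, MemLp (fun x : PhaseSpace (N + M) => x.2 (s a) ^ 2 - T) 2 (P.gibbsMeasure (N + M) T) := fun a =>
    memLp_kinetic hω hl hβ (N + M) hT (s a)
  have hk' : ∀ a, MemLp (fun x : PhaseSpace (N + M) => (x.2 (s a) ^ 2 - T) - κ * g a x) 2 (P.gibbsMeasure (N + M) T) :=
    fun a => (hk a).sub ((hgL a).const_mul κ)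
  have hd : ∀ a c, MemLp (partialP (s c) (g a)) 2 (P.gibbsMeasure (N + M) T) := fun a c =>
    memLp_partialP hω hl hβ γ (N + M) hT (termWeight s) (termWeight_nonneg s) 1 hγ (hgC a) (hgL a) (hk' a) (hpair a)
      (termWeight_pos s hs c)
  -- named quantities (density form)
  set I03 : ℝ := ∫ x, g 0 x * (x.2 (s 3) ^ 2 - T) * ρ x with hI03
  set I30 : ℝ := ∫ x, g 3 x * (x.2 (s 0) ^ 2 - T) * ρ x with hI30
  set X : ℝ := ∫ x, g 0 x * g 3 x * ρ x with hX
  set G : Fin 4 → ℝ := fun c => ∫ x, partialP (s c) (g 0) x * partialP (s c) (g 3) x * ρ x with hG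
  set P0 : ℝ := ∫ x, x.2 (s 0) * partialP (s 0) (g 3) x * ρ x with hP0
  set P3 : ℝ := ∫ x, x.2 (s 3) * partialP (s 3) (g 0) x * ρ x with hP3
  -- (polar with mass) I30 + I03 = 2 κ X + 2 γ T Σ_c G_c
  have hpol : I30 + I03 = 2 * κ * X + 2 * γ * T * ∑ c, G c := by
    have h := polar hω hl hβ (N + M) hT (termWeight s) (termWeight_nonneg s) 1 hγ (hgC 0) (hgC 3) (hgL 0) (hgL 3)
      (hk' 0) (hk' 3) (hpair 0) (hpair 3)
    rw [sum_termWeight_mul s fun i => ∫ x, partialP i (g 0) x * partialP i (g 3) x * ρ x] at h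
    have hI1 := integrable_mul_mul_gibbsDensity hω hl hβ γ (N + M) hT (hgL 3) (hk 0)
    have hI2 := integrable_mul_mul_gibbsDensity hω hl hβ γ (N + M) hT (hgL 0) (hk 3)
    have hI3 := integrable_mul_mul_gibbsDensity hω hl hβ γ (N + M) hT (hgL 0) (hgL 3)
    have e : ∫ x, (g 3 x * ((x.2 (s 0) ^ 2 - T) - κ * g 0 x) + g 0 x * ((x.2 (s 3) ^ 2 - T) - κ * g 3 x)) * ρ x =
        I30 + I03 - 2 * κ * X := by
      have : (fun x => (g 3 x * ((x.2 (s 0) ^ 2 - T) - κ * g 0 x) + g 0 x * ((x.2 (s 3) ^ 2 - T) - κ * g 3 x)) * ρ x) =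
          fun x => (g 3 x * (x.2 (s 0) ^ 2 - T) * ρ x + g 0 x * (x.2 (s 3) ^ 2 - T) * ρ x) -
            2 * κ * (g 0 x * g 3 x * ρ x) := by
        funext x; ring
      have hI12 : Integrable (fun x => g 3 x * (x.2 (s 0) ^ 2 - T) * ρ x + g 0 x * (x.2 (s 3) ^ 2 - T) * ρ x) :=
        hI1.add hI2
      rw [this, integral_sub hI12 (hI3.const_mul _), integral_add hI1 hI2, integral_const_mul]
    rw [e] at h
    simp only [hG]
    linarith
  -- (Onsager) I03 = I30
  have hons : I03 = I30 := resolvent_kuboPair_symm hω hl hβ (N + M) hT s 1 hγ κ hgC hgL hpair 0 3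
  -- (Gauss at both ends) I03 = T P3, I30 = T P0
  have hG3 : I03 = T * P3 := by
    have h := gauss_ibp hω hl hβ (N + M) hT (s 3) ((hgC 0).of_le (by norm_cast) : ContDiff ℝ 1 (g 0)) (hgL 0) (hd 0 3)
    have e : ∫ x, (x.2 (s 3) ^ 2 - T) * g 0 x * ρ x = I03 := integral_congr_ae (ae_of_all _ fun x => by ring)
    rw [e] at h
    simpa only [hP3] using h
  have hG0 : I30 = T * P0 := by
    have h := gauss_ibp hω hl hβ (N + M) hT (s 0) ((hgC 3).of_le (by norm_cast) : ContDiff ℝ 1 (g 3)) (hgL 3) (hd 3 0)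
    have e : ∫ x, (x.2 (s 0) ^ 2 - T) * g 3 x * ρ x = I30 := integral_congr_ae (ae_of_all _ fun x => by ring)
    rw [e] at h
    simpa only [hP0] using h
  -- the entry in density form
  have hK : kuboMatrix ω₂ lam β γ T N M g 0 3 = -(γ ^ 2 / T ^ 2 * (Z⁻¹ * I03)) := by
    simp only [kuboMatrix, hkin, Fin.isValue, show ((0 : Fin 4) = 3) = False by decide, if_false, zero_sub]
    rw [P.integral_gibbsMeasure]
  -- the right-hand side in density form
  have hR1 : ∫ x, g 0 x * g 3 x ∂(P.gibbsMeasure (N + M) T) = Z⁻¹ * X := by rw [P.integral_gibbsMeasure]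
  have hR2 : ∀ c, ∫ x, partialP (s c) (g 0) x * partialP (s c) (g 3) x ∂(P.gibbsMeasure (N + M) T) = Z⁻¹ * G c :=
    fun c => by rw [P.integral_gibbsMeasure]
  have hR3 : ∫ x, x.2 ⟨0, by omega⟩ * partialP ⟨0, by omega⟩ (g 3) x ∂(P.gibbsMeasure (N + M) T) = Z⁻¹ * P0 := by
    rw [P.integral_gibbsMeasure, ← hs0]
  have hR4 : ∫ x, x.2 ⟨N + M - 1, by omega⟩ * partialP ⟨N + M - 1, by omega⟩ (g 0) x ∂(P.gibbsMeasure (N + M) T) =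
      Z⁻¹ * P3 := by
    rw [P.integral_gibbsMeasure, ← hs3]
  rw [hK, hR1, hR3, hR4]
  simp_rw [hR2]
  rw [← Finset.mul_sum]
  have hZ0 : Z ≠ 0 := hZpos.ne'
  have hT0 : T ≠ 0 := hT.ne'
  field_simp
  linear_combination (1 / 2 : ℝ) * hpol - hG0 - hG3 - (1 / 2 : ℝ) * hons

/-- Registered helper sub-goal `helper_bypassGradientBudget` of stub `stub_bypassBound` (= `farGradient_sq_le_kuboDiag`
∧ `nearGradient_sq_le_kuboDiag` in stub form): the far gradient of `g_0` and the near gradient of `g_3` are paid for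
by the end self-coefficients, `N`-uniformly. -/
theorem helper_bypassGradientBudget : ∀ (ω₂ lam β γ T : ℝ), 0 < ω₂ → 0 ≤ lam → 0 ≤ β → 0 < γ → 0 < T → ∀ (N M : ℕ) (hN : 2 ≤ N) (hM : 2 ≤ M) (κ : ℝ), 0 ≤ κ → ∀ (g : Fin 4 → PhaseSpace (N + M) → ℝ), (∀ a : Fin 4, g a ∈ deviceResolventFields ω₂ lam β γ T N M (termSite N M a) κ) → γ ^ 3 / T * ∫ x, partialP ⟨N + M - 1, by omega⟩ (g 0) x ^ 2 ∂((pinnedChain ω₂ lam β γ).gibbsMeasure (N + M) T) ≤ kuboMatrix ω₂ lam β γ T N M g 0 0 ∧ γ ^ 3 / T * ∫ x, partialP ⟨0, by omega⟩ (g 3) x ^ 2 ∂((pinnedChain ω₂ lam β γ).gibbsMeasure (N + M) T) ≤ kuboMatrix ω₂ lam β γ T N M g 3 3 :=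
  fun _ _ _ _ _ hω hl hβ hγ hT _ _ hN hM _ hκ g hg =>
    ⟨farGradient_sq_le_kuboDiag hω hl hβ hγ hT hN hM hκ g (hg 0), nearGradient_sq_le_kuboDiag hω hl hβ hγ hT hN hM hκ g (hg 3)⟩


end Gram

end Summit.AtomisticToContinuum.FouriersLaw.Cruxes.SuperadditiveResistance.FloatingProbeBypassLaplacian

end
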